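import Summits.Schanuel.Schanuel.Theorems.SoloInformedConjugateConvexRigidity
import Summits.Schanuel.Schanuel.Theorems.SoloInformedCheapFactor

/-!
# Roots on an arithmetic progression: half are pairwise non-conjugate, one is cheap

Soloist file (informed mode, seat `solo-Schanuel-informed`, s179).  Step (i) of the ENDGAME
LEMMA of the seat's note `paper/AE-note.md` §6 (`η = 0` form, Remark R5): if a non-zero
`P ∈ ℤ[X]` vanishes at the points `γ + s μ` (`s ∈ S ⊆ ℕ`, `μ ≠ 0`) of an arithmetic
progression, then by LEMMA H (`soloCC_no_three_roots_in_rational_progression`: an irreducible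
polynomial over `ℚ` has at most two roots on such a progression) at least half of these points
are pairwise NON-CONJUGATE over `ℚ`, and then the pigeonhole of
`SoloInformedCheapFactor` (`soloCF_exists_cheap_factor`) produces one of them lying on an
irreducible factor `q ∣ P` of small degree and small Mahler measure.

Contents (prefix `soloNC_`):
* `soloNC_isIntegral` — a complex root of a non-zero integer polynomial is integral over `ℚ`;
* `soloNC_card_filter_minpoly_le_two` — each minimal polynomial occurs at most twice along
  the progression (Lemma H);
* `soloNC_exists_nonconjugate_half` — `∃ T ⊆ S`, `#S ≤ 2 #T`, pairwise distinct minimal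
  polynomials on `T`;
* `soloNC_exists_cheap_factor_on_progression` — if
  `2 (deg P / d₀ + log M(P) / h₀) < #S` then some `γ + s μ` (`s ∈ S`) is a root of an
  irreducible `q ∣ P` with `0 < deg q ≤ d₀`, `log M(q) ≤ h₀`.

What this is NOT.  One elementary input of the seat's pen-and-paper THEOREM AE-1 on the node
`RoyAdditiveDirichletExponent` ([cite: Roy2010, Thm 1.1]; small value estimates for the
additive group); the assembly with the served set, Lemma AE, Theorem C, the dilated factor and
Gel'fond's criterion is not in this file, and nothing here bears on
`Literature.Periods.SchanuelConjecture` (the seat's verdict, no path, is unchanged).  Mathlib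
and two tree files only; no definitions, no literature hypothesis; axioms the standard three.
-/

namespace Summit.Schanuel.Schanuel.Theorems

open Polynomial Finset

/-- A complex root of a non-zero integer polynomial is integral over `ℚ`. -/
theorem soloNC_isIntegral (P : ℤ[X]) (hP : P ≠ 0) {x : ℂ} (hx : aeval x P = 0) :
    IsIntegral ℚ x := by
  refine isAlgebraic_iff_isIntegral.mp ⟨P.map (algebraMap ℤ ℚ), ?_, ?_⟩
  · exact (Polynomial.map_ne_zero_iff (algebraMap ℤ ℚ).injective_int).mpr hP
  · rw [aeval_map_algebraMap]
    exact hx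

/-- **At most two conjugates on a progression (Lemma H, counted).**  If `P ≠ 0` in `ℤ[X]`
vanishes at `γ + s μ` for all `s ∈ S` (`μ ≠ 0`), then for every `p ∈ ℚ[X]` at most two
`s ∈ S` have `minpoly_ℚ (γ + s μ) = p`. -/
theorem soloNC_card_filter_minpoly_le_two (P : ℤ[X]) (hP : P ≠ 0) (γ μ : ℂ) (hμ : μ ≠ 0)
    (S : Finset ℕ) (hroot : ∀ s ∈ S, aeval (γ + (s : ℂ) * μ) P = 0) (p : ℚ[X]) :
    #(S.filter (fun s : ℕ => minpoly ℚ (γ + (s : ℂ) * μ) = p)) ≤ 2 := by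
  classical
  set F := S.filter (fun s : ℕ => minpoly ℚ (γ + (s : ℂ) * μ) = p) with hF
  refine le_of_not_gt (fun hlt => ?_)
  obtain ⟨x, hx, y, hy, z, hz, hxy, hxz, hyz⟩ := Finset.two_lt_card.mp hlt
  have hFne : F.Nonempty := ⟨x, hx⟩
  set s₁ := F.min' hFne with hs₁
  set s₃ := F.max' hFne with hs₃
  have h1 : s₁ ∈ F := F.min'_mem hFne
  have h3 : s₃ ∈ F := F.max'_mem hFne
  have key : ∃ s₂ ∈ F, s₂ ≠ s₁ ∧ s₂ ≠ s₃ := by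
    by_cases hx' : x ≠ s₁ ∧ x ≠ s₃
    · exact ⟨x, hx, hx'⟩
    by_cases hy' : y ≠ s₁ ∧ y ≠ s₃
    · exact ⟨y, hy, hy'⟩
    refine ⟨z, hz, ?_⟩
    omega
  obtain ⟨s₂, h2, h21, h23⟩ := key
  have h12 : s₁ < s₂ := lt_of_le_of_ne (F.min'_le s₂ h2) (Ne.symm h21)
  have h23' : s₂ < s₃ := lt_of_le_of_ne (F.le_max' s₂ h2) h23
  -- the common minimal polynomial `p` is irreducible and vanishes at the three points
  have hmem : ∀ s ∈ F, s ∈ S ∧ minpoly ℚ (γ + (s : ℂ) * μ) = p := fun s hs =>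
    Finset.mem_filter.mp hs
  have hval : ∀ s ∈ F, aeval (γ + ((s : ℚ) : ℂ) * μ) p = 0 := by
    intro s hs
    rw [← (hmem s hs).2]
    push_cast
    exact minpoly.aeval ℚ _
  have hirr : Irreducible p := by
    rw [← (hmem s₁ h1).2]
    exact minpoly.irreducible (soloNC_isIntegral P hP (hroot s₁ (hmem s₁ h1).1))
  exact soloCC_no_three_roots_in_rational_progression p hirr hμ
    (by exact_mod_cast h12) (by exact_mod_cast h23') (hval s₁ h1) (hval s₂ h2) (hval s₃ h3)

/-- **Half of the structured roots are pairwise non-conjugate.**  If `P ≠ 0` in `ℤ[X]`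
vanishes at `γ + s μ` for all `s ∈ S` (`μ ≠ 0`), there is `T ⊆ S` with `#S ≤ 2 #T` on which
the minimal polynomials `minpoly_ℚ (γ + s μ)` are pairwise distinct. -/
theorem soloNC_exists_nonconjugate_half (P : ℤ[X]) (hP : P ≠ 0) (γ μ : ℂ) (hμ : μ ≠ 0)
    (S : Finset ℕ) (hroot : ∀ s ∈ S, aeval (γ + (s : ℂ) * μ) P = 0) :
    ∃ T ⊆ S, #S ≤ 2 * #T ∧ ∀ s ∈ T, ∀ s' ∈ T, s ≠ s' →
      minpoly ℚ (γ + (s : ℂ) * μ) ≠ minpoly ℚ (γ + (s' : ℂ) * μ) := by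
  classical
  set f : ℕ → ℚ[X] := fun s : ℕ => minpoly ℚ (γ + (s : ℂ) * μ) with hf
  set g : ℚ[X] → ℕ := Function.invFunOn f (S : Set ℕ) with hg
  have hsec : ∀ a ∈ S.image f, g a ∈ S ∧ f (g a) = a := by
    intro a ha
    obtain ⟨s, hs, rfl⟩ := Finset.mem_image.mp ha
    have h : ∃ x ∈ (S : Set ℕ), f x = f s := ⟨s, hs, rfl⟩
    exact ⟨Function.invFunOn_mem h, Function.invFunOn_eq h⟩
  have hfiber : ∀ a ∈ S.image f, #(S.filter (fun s : ℕ => f s = a)) ≤ 2 := fun a _ =>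
    soloNC_card_filter_minpoly_le_two P hP γ μ hμ S hroot a
  refine ⟨(S.image f).image g, ?_, ?_, ?_⟩
  · intro s hs
    obtain ⟨a, ha, rfl⟩ := Finset.mem_image.mp hs
    exact (hsec a ha).1
  · have hinj : Set.InjOn g (S.image f : Set ℚ[X]) := by
      intro a ha a' ha' h
      rw [← (hsec a ha).2, ← (hsec a' ha').2, h]
    rw [Finset.card_image_of_injOn hinj]
    exact Finset.card_le_mul_card_image S 2 hfiber
  · intro s hs s' hs' hne
    obtain ⟨a, ha, rfl⟩ := Finset.mem_image.mp hs
    obtain ⟨a', ha', rfl⟩ := Finset.mem_image.mp hs'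
    change f (g a) ≠ f (g a')
    rw [(hsec a ha).2, (hsec a' ha').2]
    intro h
    exact hne (by rw [h])

/-- **A cheap factor on a progression.**  Let `P ≠ 0` in `ℤ[X]` vanish at `γ + s μ` for all
`s ∈ S` (`μ ≠ 0`), and let `d₀, h₀ > 0` satisfy `2 (deg P / d₀ + log M(P) / h₀) < #S`.  Then
some `γ + s μ`, `s ∈ S`, is a root of an irreducible factor `q ∣ P` in `ℤ[X]` with
`0 < deg q ≤ d₀` and `log M(q) ≤ h₀`.  (Half of the points are pairwise non-conjugate by
`soloNC_exists_nonconjugate_half`; apply `soloCF_exists_cheap_factor` to them.) -/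
theorem soloNC_exists_cheap_factor_on_progression (P : ℤ[X]) (hP : P ≠ 0) (γ μ : ℂ)
    (hμ : μ ≠ 0) (S : Finset ℕ) (hroot : ∀ s ∈ S, aeval (γ + (s : ℂ) * μ) P = 0)
    {d₀ h₀ : ℝ} (hd₀ : 0 < d₀) (hh₀ : 0 < h₀)
    (hS : 2 * (P.natDegree / d₀ + Real.log (P.map (Int.castRingHom ℂ)).mahlerMeasure / h₀)
      < #S) :
    ∃ s ∈ S, ∃ q : ℤ[X], Irreducible q ∧ 0 < q.natDegree ∧ q ∣ P ∧
      aeval (γ + (s : ℂ) * μ) q = 0 ∧ (q.natDegree : ℝ) ≤ d₀ ∧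
      Real.log (q.map (Int.castRingHom ℂ)).mahlerMeasure ≤ h₀ := by
  classical
  obtain ⟨T, hTS, hcard, hnc⟩ := soloNC_exists_nonconjugate_half P hP γ μ hμ S hroot
  set e : ℕ → ℂ := fun s : ℕ => γ + (s : ℂ) * μ with he
  have heinj : Function.Injective e := by
    intro s s' h
    have h' : (s : ℂ) * μ = (s' : ℂ) * μ := add_left_cancel h
    exact_mod_cast mul_right_cancel₀ hμ h'
  have hTe : #(T.image e) = #T := Finset.card_image_of_injective T heinj
  have hroot' : ∀ α ∈ T.image e, aeval α P = 0 := by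
    intro α hα
    obtain ⟨s, hs, rfl⟩ := Finset.mem_image.mp hα
    exact hroot s (hTS hs)
  have hnc' : ∀ α ∈ T.image e, ∀ α' ∈ T.image e, α ≠ α' → minpoly ℚ α ≠ minpoly ℚ α' := by
    intro α hα α' hα' hne
    obtain ⟨s, hs, rfl⟩ := Finset.mem_image.mp hα
    obtain ⟨s', hs', rfl⟩ := Finset.mem_image.mp hα'
    exact hnc s hs s' hs' (fun h => hne (by rw [h]))
  have hT : P.natDegree / d₀ + Real.log (P.map (Int.castRingHom ℂ)).mahlerMeasure / h₀
      < #(T.image e) := by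
    rw [hTe]
    have : (#S : ℝ) ≤ 2 * #T := by exact_mod_cast hcard
    linarith
  obtain ⟨α, hα, q, hq, hdeg, hdvd, hval, hd, hh⟩ :=
    soloCF_exists_cheap_factor P hP (T.image e) hroot' hnc' hd₀ hh₀ hT
  obtain ⟨s, hs, rfl⟩ := Finset.mem_image.mp hα
  exact ⟨s, hTS hs, q, hq, hdeg, hdvd, hval, hd, hh⟩

end Summit.Schanuel.Schanuel.Theorems
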